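/-
Copyright (c) 2026 the pub-hodgecm-mathlib formalisation cell (harness21).  Prover seat hodgecm-mathlib-K2Liu-p03 (g7): Track B «K2-LIT», hLiu418 = stmt-HodgeConjecture-24832,
socket #41, the I4 block, brick (D1) FILE 3 «THE TWO (β0-hol) LETTERS OF ★ I4 ED. 4 AT THE TWO-LINE DATUM» (LEAD F0P6-plan (g14) BATCH #82 (1); I4 desk K2E4-p11 (g8)).
-/
import Summits.HodgeConjecture.HodgeConjecture.Theorems.K2LiuSiegelMiddleTermCornerMajorant    -- ★ (D1) FILE 1 `hint_and_hFhol_of_cornerHeight` (the letters from `hJ`)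
import Summits.HodgeConjecture.HodgeConjecture.Theorems.K2LiuCornerLineSectionIntegrable        -- ★ (D1) FILE 2 `integrable_cornerLine_height` (`hJ` on the line chart)
import Summits.HodgeConjecture.HodgeConjecture.Theorems.K2LiuLineCornerChart                    -- ★ (T4-β) `exists_lineChart`, `cornerLine_eq_blkD_lineChart` (F0P2-p11)
import Summits.HodgeConjecture.HodgeConjecture.Theorems.K2LiuLineCornerChartHaar                -- ★ (T4-β) HAAR LETTER `isHaarMeasure_map_lineChart` (F0P2-p11, p862728) — ED. 2
import Summits.HodgeConjecture.HodgeConjecture.Theorems.K2LiuCornerLineChartTwoInl              -- ★ (T4) `inl` TWIN `cornerLine_eq_blkD_lineChart_inl` (F0P2-p11) — ED. 3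
import Summits.HodgeConjecture.HodgeConjecture.Theorems.K2LiuUnipDeltaCornerUnfoldC                -- ★ C-part `inner_section_unfold` — ED. 3
import HarnessLib

/-!
# Crux `HLiu418`, socket #41, I4 block, (D1) FILE 3: ★ I4 ED. 4's analytic letters `hint` ∕ `hFhol` AT THE TWO-LINE DATUM (`V = L·e₀ ⊕ L·e₁`, `e (1,0) = 1`),
# modulo ONE measure letter — the line chart carries additive Haar measures of `𝔸_{L⁺}` to Haar measures of `N_Δ⁽ᴮ⁾(𝔸)`

Cell `hodgecm-mathlib`, crux item hLiu418 = `stmt-HodgeConjecture-24832`; squad K2 ∕ K2Liu; prover K2Liu-p03 (g7) (LEAD F0P6-plan (g14) BATCH #82 (1); I4 desk K2E4-p11 (g8)).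
THEOREMS ONLY (no `def`, no instance, no notation, no named-fact hypothesis, no `sorry`); lane `--supports stmt-HodgeConjecture-24832 --as helper`.

THE ASSEMBLY.  ★ (D1) FILE 1 `K2LiuSiegelMiddleTermCornerMajorant.hint_and_hFhol_of_cornerHeight` pays ★ I4 ED. 4's `hint`∕`hFhol` from the corner-line height letter
`hJ : ∀ n₂ (corner line of ★ C-part) σ > 0 μ (additive Haar of 𝔸_{L⁺}), Integrable (t ↦ H_𝒦(w₀ · n₂ t)^{2σ+2}) μ`; ★ (D1) FILE 2 `K2LiuCornerLineSectionIntegrable.integrable_cornerLine_height`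
pays that integrability on any LINE CHART `nB` with a Haar push-forward and `n₂ t = blkD (1, nB t)`; ★ (T4-β) `K2LiuLineCornerChart` (F0P2-p11 (g2)) supplies the chart
(`exists_lineChart`: continuous, additive, corner coordinate `(t⊗1)δ`) and the identification (`cornerLine_eq_blkD_lineChart`: every corner line of ★ C-part IS `blkD (1, nB ·)`).
AT THE TWO-LINE DATUM of ★ (T4-α) part 3 — `e : Fin (1+1) × Fin 1 ≃ Fin 2` with `e (1,0) = 1`, `dV : Fin (1+1) → L`, `dW : Fin 1 → L`; the summand data are DEFINED from `dV`
(`dA i := dV (castAdd 1 i)`, `dB j := dV (natAdd 1 j)`, `eA = eB := Equiv.prodUnique (Fin 1) (Fin 1)`, so `hVA hVB` are `rfl` and no new binder appears) — this leaves exactly ONE letter: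
  `hHaar` : for every chart `nB` as above and every additive Haar measure `μ` of `𝔸_{L⁺}`, `Measure.map nB μ` is a Haar measure on `N_Δ⁽ᴮ⁾(𝔸)`
(the chart is a topological isomorphism `𝔸_{L⁺} ≅ N_Δ⁽ᴮ⁾(𝔸)`; F0P2-p11 (g2)'s announced `K2LiuLineCornerChartHaar`, 22:45:20Z) — and gives
* **`hint_and_hFhol_of_lineHaar`** — `hint : ∀ s, 0 < re s → ∀ k ∈ 𝒦.K, Integrable (u ↦ (β₁ u).toReal • f_s(w₀·(u·k))) νN` AND `hFhol : ∀ y, DifferentiableOn ℂ (s ↦ F_s y) {0 < re}`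
  (★ I4 ED. 4 `exists_middleTerm_package_of_standard` :294–296 BYTE FOR BYTE at `N := 1+1`, `M := 1`) for a STANDARD family `f` with continuous members and unitary `χ`, modulo `hHaar`.
[MoeglinWaldspurger1995, II.1.6–II.1.7, IV.1.9]; [KudlaRallis1994, §2 (2.10)–(2.12)]; [Tan1999, §4 Prop. 4.8]; [Kudla1994, §2]; [Conway1978, IV §2].
* (ED. 2) **`hint_and_hFhol_of_standard`** — THE SAME WITH NO LETTER: `hHaar` discharged by ★ `K2LiuLineCornerChartHaar.isHaarMeasure_map_lineChart` (F0P2-p11 (g2), p862728).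
* (ED. 3) **`hint_and_hFhol_of_standard'`** — ORIENTATION-FREE (no `e (1,0) = 1`: case `e (1,0) = 1` on the second line, case `e (1,0) = 0` on the first line via ★ `K2LiuCornerLineChartTwoInl` +
  ★ `K2LiuCornerLineSectionIntegrable` ED. 2 `integrable_cornerLine_height_inl`) AND `hint` ON ALL TRANSLATES `y` — the binders of ★ I4 ED. 5 `exists_middleTerm_package_of_standard_level`
  (K2E4-p11, p862751) BYTE FOR BYTE (I4 desk flag 22:52:30Z).
HONEST LABEL.  Count-neutral helper: `HC_CM` is proved only modulo the 7 printed citations (2 remaining named inputs: hLiu418 = `stmt-HodgeConjecture-24832`,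
h413 = `stmt-HodgeConjecture-24833`) until rung 0 closes.
-/

set_option autoImplicit false
set_option linter.dupNamespace false -- the mandated namespace repeats `HodgeConjecture.HodgeConjecture`

noncomputable section

open scoped Matrix ENNReal NNReal
open NumberField IsDedekindDomain MeasureTheory MeasureTheory.Measure Filter Topology
open Literature.NumberTheory.Automorphic Literature.NumberTheory.Automorphic.UnitaryGroup Literature.NumberTheory.GaloisRepresentations
open Literature.NumberTheory.GelbartRogawski1991 Literature.NumberTheory.GelbartRogawski1991.GRConstruction
open Literature.NumberTheory.GelbartRogawski1991.AdaptedBlocks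
open Literature.NumberTheory.K2Lit.SiegelDoubled Literature.MeasureTheory.Group
open UnitaryDualPair
open Summit.HodgeConjecture.HodgeConjecture.Cruxes.HLiu418.K2LiuSiegelMiddleTermCornerMajorant (hint_and_hFhol_of_cornerHeight integrable_corner_of_height differentiableOn_corner_of_height)
open Summit.HodgeConjecture.HodgeConjecture.Cruxes.HLiu418.K2LiuCornerLineSectionIntegrable (integrable_cornerLine_height integrable_cornerLine_height_inl)
open Summit.HodgeConjecture.HodgeConjecture.Cruxes.HLiu418.K2LiuLineCornerChart (exists_lineChart cornerLine_eq_blkD_lineChart)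
open Summit.HodgeConjecture.HodgeConjecture.Cruxes.HLiu418.K2LiuLineCornerChartHaar (isHaarMeasure_map_lineChart)
open Summit.HodgeConjecture.HodgeConjecture.Cruxes.HLiu418.K2LiuCornerLineChartTwoInl (cornerLine_eq_blkD_lineChart_inl)
open Summit.HodgeConjecture.HodgeConjecture.Cruxes.HLiu418.K2LiuUnipDeltaCornerUnfoldC (inner_section_unfold)

namespace Summit.HodgeConjecture.HodgeConjecture.Cruxes.HLiu418.K2LiuSiegelMiddleTermCornerLetters

variable (L : Type) [Field L] [NumberField L] [IsCMField L]
variable (e : Fin (1 + 1) × Fin 1 ≃ Fin 2)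
  (dV : Fin (1 + 1) → L) (hdV : ∀ i, IsCMField.complexConj L (dV i) = dV i) (hdV0 : ∀ i, dV i ≠ 0)
  (dW : Fin 1 → L) (hdW : ∀ i, IsCMField.complexConj L (dW i) = dW i) (hdW0 : ∀ i, dW i ≠ 0)
variable [MeasurableSpace (unipDelta L e dV hdV dW hdW)] [BorelSpace (unipDelta L e dV hdV dW hdW)]

variable {g₀ : UnitaryGroup.rationalPair (Fp L) L (IsCMField.complexConj L) (1 + 1) 1 (Matrix.diagonal dV) (Matrix.diagonal dW)}
  (hg₀ : ((g₀ : GL (Fin (1 + 1) × Fin 1) L) : Matrix (Fin (1 + 1) × Fin 1) (Fin (1 + 1) × Fin 1) L) = Matrix.diagonal (fun k => 1 - 2 * (![0, 1] : Fin 2 → L) (e k)))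
  (Λ : GL (Fin 2) (AdeleRing (𝓞 L) L) →* HA L e dV hdV dW hdW)
  (hΛ : ∀ g : GL (Fin 2) (AdeleRing (𝓞 L) L), blk L e dV hdV dW hdW (Λ g) =
    cayR (AdeleRing (𝓞 L) L) (Fin 2) * Matrix.fromBlocks (g : Matrix (Fin 2) (Fin 2) (AdeleRing (𝓞 L) L)) 0 0
      (((gramR L e dV hdV dW hdW).map ((algebraMap L (AdeleRing (𝓞 L) L)).comp (algebraMap (Fp L) L)))⁻¹ *
        (((g⁻¹ : GL (Fin 2) (AdeleRing (𝓞 L) L)) : Matrix (Fin 2) (Fin 2) (AdeleRing (𝓞 L) L)).map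
          (conjAdele (Fp L) L (IsCMField.complexConj L)))ᵀ *
        (gramR L e dV hdV dW hdW).map ((algebraMap L (AdeleRing (𝓞 L) L)).comp (algebraMap (Fp L) L))) *
      cayRinv (AdeleRing (𝓞 L) L) (Fin 2))
  (Γ₀ : Subgroup (unipDelta L e dV hdV dW hdW))
  (hΓ₀ : ∀ u : unipDelta L e dV hdV dW hdW, u ∈ Γ₀ ↔ (u : HA L e dV hdV dW hdW) ∈ ratH L e dV hdV dW hdW ∧
    IsSiegelDelta L e dV hdV dW hdW (iotaGG L e dV hdV dW hdW (1, UnitaryGroup.rationalPairToAdelic (Fp L) L (IsCMField.complexConj L) (1 + 1) 1 (Matrix.diagonal dV) (Matrix.diagonal dW) g₀) * (u : HA L e dV hdV dW hdW) * (iotaGG L e dV hdV dW hdW (1, UnitaryGroup.rationalPairToAdelic (Fp L) L (IsCMField.complexConj L) (1 + 1) 1 (Matrix.diagonal dV) (Matrix.diagonal dW) g₀))⁻¹))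

include hg₀ hΛ hΓ₀ hdV0 hdW0 in
/-- **(D1) ★ I4 ED. 4's `hint` AND `hFhol` AT THE TWO-LINE DATUM, MODULO THE HAAR LETTER OF THE LINE CHART.**  `e : Fin (1+1) × Fin 1 ≃ Fin 2` with `e (1,0) = 1`; the datum letters
`hg₀ Λ hΛ Γ₀ hΓ₀` of ★ α3-2 ∕ ★ I4; `νN` Haar on `N_Δ(𝔸)`, `β₁` a `Γ₀`-covering weight, `χ` UNITARY, `f` STANDARD for `𝒦` with continuous members, `F` the inner section by value;
`hHaar`: every continuous additive line chart `nB : 𝔸_{L⁺} → N_Δ⁽ᴮ⁾(𝔸)` with corner coordinate `(t⊗1)δ` (★ `exists_lineChart`'s clauses; `V₂ = L·e₁`, `dB = dV ∘ natAdd 1`) pushes additive Haar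
measures forward to Haar measures.  Then BOTH analytic letters of ★ `exists_middleTerm_package_of_standard` hold (bytes :294–296 at `N := 1+1`, `M := 1`): ★ FILE 1 at the height letter
`hJ`, itself ★ FILE 2 `integrable_cornerLine_height` on the chart of ★ `exists_lineChart`, identified with ★ C-part's corner line by ★ `cornerLine_eq_blkD_lineChart`.
[cite: MoeglinWaldspurger1995, II.1.7, IV.1.9] [cite: KudlaRallis1994, §2 (2.10)–(2.12)] [cite: Tan1999, §4 Prop. 4.8] [cite: Kudla1994, §2] [cite: Conway1978, IV §2] -/
theorem hint_and_hFhol_of_lineHaar (he : e (1, 0) = 1)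
    (νN : Measure (unipDelta L e dV hdV dW hdW)) [νN.IsHaarMeasure] {β₁ : unipDelta L e dV hdV dW hdW → ℝ≥0∞} (hβ₁ : IsCoveringWeight Γ₀ β₁)
    {χ : HeckeCharacter L} (hχ : χ.IsUnitary) (𝒦 : IwasawaDatum L e dV hdV dW hdW)
    (f : ℂ → HA L e dV hdV dW hdW → ℂ) (hstd : IsStandardSectionFamily 𝒦 χ f) (hcont : ∀ s : ℂ, Continuous (f s))
    (F : ℂ → HA L e dV hdV dW hdW → ℂ)
    (hF : ∀ (s : ℂ) (x : HA L e dV hdV dW hdW), F s x = ∫ u, (β₁ u).toReal • f s (iotaGG L e dV hdV dW hdW (1, UnitaryGroup.rationalPairToAdelic (Fp L) L (IsCMField.complexConj L) (1 + 1) 1 (Matrix.diagonal dV) (Matrix.diagonal dW) g₀) * ((u : HA L e dV hdV dW hdW) * x)) ∂νN)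
    (hHaar : ∀ (nB : AdeleRing (𝓞 (Fp L)) (Fp L) →
        unipDelta L (Equiv.prodUnique (Fin 1) (Fin 1)) (fun j => dV (Fin.natAdd 1 j)) (fun j => hdV (Fin.natAdd 1 j)) dW hdW),
      Continuous nB → (∀ s t, nB (s + t) = nB s * nB t) →
      (∀ t, (blk L (Equiv.prodUnique (Fin 1) (Fin 1)) (fun j => dV (Fin.natAdd 1 j)) (fun j => hdV (Fin.natAdd 1 j)) dW hdW
          (nB t : HA L (Equiv.prodUnique (Fin 1) (Fin 1)) (fun j => dV (Fin.natAdd 1 j)) (fun j => hdV (Fin.natAdd 1 j)) dW hdW)).toBlocks₁₂ =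
        Matrix.of fun _ _ => AdeleRing.baseChange (Fp L) L t * algebraMap L (AdeleRing (𝓞 L) L) (imagUnit L)) →
      ∀ (mA : MeasurableSpace (AdeleRing (𝓞 (Fp L)) (Fp L))) (μ : Measure (AdeleRing (𝓞 (Fp L)) (Fp L))),
        BorelSpace (AdeleRing (𝓞 (Fp L)) (Fp L)) → μ.IsAddHaarMeasure →
        ∀ (mB : MeasurableSpace (unipDelta L (Equiv.prodUnique (Fin 1) (Fin 1)) (fun j => dV (Fin.natAdd 1 j)) (fun j => hdV (Fin.natAdd 1 j)) dW hdW)),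
          BorelSpace (unipDelta L (Equiv.prodUnique (Fin 1) (Fin 1)) (fun j => dV (Fin.natAdd 1 j)) (fun j => hdV (Fin.natAdd 1 j)) dW hdW) →
          (Measure.map nB μ).IsHaarMeasure) :
    (∀ s : ℂ, 0 < s.re → ∀ k : HA L e dV hdV dW hdW, k ∈ 𝒦.K →
      Integrable (fun u : unipDelta L e dV hdV dW hdW => (β₁ u).toReal • f s (iotaGG L e dV hdV dW hdW (1, UnitaryGroup.rationalPairToAdelic (Fp L) L (IsCMField.complexConj L) (1 + 1) 1 (Matrix.diagonal dV) (Matrix.diagonal dW) g₀) * ((u : HA L e dV hdV dW hdW) * k))) νN) ∧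
    (∀ y : HA L e dV hdV dW hdW, DifferentiableOn ℂ (fun s => F s y) {s : ℂ | 0 < s.re}) := by
  refine hint_and_hFhol_of_cornerHeight L dV hdV hdV0 dW hdW hdW0 e hg₀ Λ hΛ Γ₀ hΓ₀ νN hβ₁ hχ 𝒦 f hstd hcont F hF
    fun n₂ hn₂c hn₂mem hn₂X σ hσ mA μ hBor hμ => ?_
  -- the two lines of `V`, read from `dV` (no new binder)
  haveI := hBor
  haveI := hμ
  obtain ⟨nB, hnBc, hnBadd, hnBX⟩ := exists_lineChart L (Equiv.prodUnique (Fin 1) (Fin 1)) (fun j => dV (Fin.natAdd 1 j)) (fun j => hdV (Fin.natAdd 1 j)) dW hdW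
  letI mB : MeasurableSpace (unipDelta L (Equiv.prodUnique (Fin 1) (Fin 1)) (fun j => dV (Fin.natAdd 1 j)) (fun j => hdV (Fin.natAdd 1 j)) dW hdW) := borel _
  haveI hB : BorelSpace (unipDelta L (Equiv.prodUnique (Fin 1) (Fin 1)) (fun j => dV (Fin.natAdd 1 j)) (fun j => hdV (Fin.natAdd 1 j)) dW hdW) := ⟨rfl⟩
  have hH := hHaar nB hnBc hnBadd hnBX mA μ hBor hμ mB hB
  have hn₂ : ∀ t, n₂ t = blkD L e (Equiv.prodUnique (Fin 1) (Fin 1)) (Equiv.prodUnique (Fin 1) (Fin 1))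
      (fun i => dV (Fin.castAdd 1 i)) (fun i => hdV (Fin.castAdd 1 i)) (fun j => dV (Fin.natAdd 1 j)) (fun j => hdV (Fin.natAdd 1 j))
      dV hdV (fun _ => rfl) (fun _ => rfl) dW hdW
      (1, ((nB t : unipDelta L (Equiv.prodUnique (Fin 1) (Fin 1)) (fun j => dV (Fin.natAdd 1 j)) (fun j => hdV (Fin.natAdd 1 j)) dW hdW) :
        HA L (Equiv.prodUnique (Fin 1) (Fin 1)) (fun j => dV (Fin.natAdd 1 j)) (fun j => hdV (Fin.natAdd 1 j)) dW hdW)) := fun t =>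
    cornerLine_eq_blkD_lineChart L e (Equiv.prodUnique (Fin 1) (Fin 1)) (Equiv.prodUnique (Fin 1) (Fin 1))
      (fun i => dV (Fin.castAdd 1 i)) (fun i => hdV (Fin.castAdd 1 i)) (fun j => dV (Fin.natAdd 1 j)) (fun j => hdV (Fin.natAdd 1 j))
      dV hdV (fun _ => rfl) (fun _ => rfl) dW hdW he nB hnBX n₂ hn₂mem hn₂X t
  exact integrable_cornerLine_height L e (Equiv.prodUnique (Fin 1) (Fin 1)) (Equiv.prodUnique (Fin 1) (Fin 1))
    (fun i => dV (Fin.castAdd 1 i)) (fun i => hdV (Fin.castAdd 1 i)) (fun j => dV (Fin.natAdd 1 j)) (fun j => hdV (Fin.natAdd 1 j)) (fun j => hdV0 _)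
    dV hdV hdV0 (fun _ => rfl) (fun _ => rfl) dW hdW hdW0 he hg₀ μ nB hnBc.measurable.aemeasurable hH n₂ hn₂ 𝒦 hσ

include hg₀ hΛ hΓ₀ hdV0 hdW0 in
/-- **(D1) ★ I4 ED. 4's `hint` AND `hFhol` AT THE TWO-LINE DATUM — NO LETTER (ED. 2).**  `e : Fin (1+1) × Fin 1 ≃ Fin 2` with `e (1,0) = 1`; ★ α3-2's datum letters; `νN` Haar, `β₁` a
`Γ₀`-covering weight, `χ` unitary, `f` STANDARD for `𝒦` with continuous members, `F` the inner section by value.  Then `hint : ∀ s, 0 < re s → ∀ k ∈ 𝒦.K, Integrable (u ↦ (β₁ u).toReal •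
f_s(w₀·(u·k))) νN` and `hFhol : ∀ y, DifferentiableOn ℂ (s ↦ F_s y) {0 < re}` — ★ `exists_middleTerm_package_of_standard` :294–296 BYTE FOR BYTE at `N := 1+1`, `M := 1` (`hint_and_hFhol_of_lineHaar`
with `hHaar :=` ★ `K2LiuLineCornerChartHaar.isHaarMeasure_map_lineChart` at the second summand `dB = dV ∘ natAdd 1`).
[cite: MoeglinWaldspurger1995, II.1.7, IV.1.9] [cite: KudlaRallis1994, §2 (2.10)–(2.12)] [cite: Tan1999, §4 Prop. 4.8] [cite: Kudla1994, §2] [cite: Conway1978, IV §2] -/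
theorem hint_and_hFhol_of_standard (he : e (1, 0) = 1)
    (νN : Measure (unipDelta L e dV hdV dW hdW)) [νN.IsHaarMeasure] {β₁ : unipDelta L e dV hdV dW hdW → ℝ≥0∞} (hβ₁ : IsCoveringWeight Γ₀ β₁)
    {χ : HeckeCharacter L} (hχ : χ.IsUnitary) (𝒦 : IwasawaDatum L e dV hdV dW hdW)
    (f : ℂ → HA L e dV hdV dW hdW → ℂ) (hstd : IsStandardSectionFamily 𝒦 χ f) (hcont : ∀ s : ℂ, Continuous (f s))
    (F : ℂ → HA L e dV hdV dW hdW → ℂ)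
    (hF : ∀ (s : ℂ) (x : HA L e dV hdV dW hdW), F s x = ∫ u, (β₁ u).toReal • f s (iotaGG L e dV hdV dW hdW (1, UnitaryGroup.rationalPairToAdelic (Fp L) L (IsCMField.complexConj L) (1 + 1) 1 (Matrix.diagonal dV) (Matrix.diagonal dW) g₀) * ((u : HA L e dV hdV dW hdW) * x)) ∂νN) :
    (∀ s : ℂ, 0 < s.re → ∀ k : HA L e dV hdV dW hdW, k ∈ 𝒦.K →
      Integrable (fun u : unipDelta L e dV hdV dW hdW => (β₁ u).toReal • f s (iotaGG L e dV hdV dW hdW (1, UnitaryGroup.rationalPairToAdelic (Fp L) L (IsCMField.complexConj L) (1 + 1) 1 (Matrix.diagonal dV) (Matrix.diagonal dW) g₀) * ((u : HA L e dV hdV dW hdW) * k))) νN) ∧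
    (∀ y : HA L e dV hdV dW hdW, DifferentiableOn ℂ (fun s => F s y) {s : ℂ | 0 < s.re}) :=
  hint_and_hFhol_of_lineHaar L e dV hdV hdV0 dW hdW hdW0 hg₀ Λ hΛ Γ₀ hΓ₀ he νN hβ₁ hχ 𝒦 f hstd hcont F hF
    fun nB hnBc hnBadd hnBX _ μ hBor hμ _ hB => by
      haveI := hBor
      haveI := hμ
      haveI := hB
      exact isHaarMeasure_map_lineChart L (Equiv.prodUnique (Fin 1) (Fin 1)) (fun j => dV (Fin.natAdd 1 j)) (fun j => hdV (Fin.natAdd 1 j)) dW hdW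
        (fun j => hdV0 _) hdW0 μ nB hnBc hnBadd hnBX

/-! ## (ED. 3) Orientation-free, all translates -/

include hg₀ hΛ hΓ₀ hdV0 hdW0 in
/-- **(D1) ★ I4 ED. 5's `hint` AND `hFhol` — ORIENTATION-FREE, ALL TRANSLATES, NO LETTER.**  `e : Fin (1+1) × Fin 1 ≃ Fin 2` ARBITRARY (the socket's frame after `subst hn2`; `Fin (1+1)`
unifies with `Fin 2` by `rfl`); ★ α3-2's datum letters; `νN` Haar, `β₁` a `Γ₀`-covering weight, `χ` unitary, `f` STANDARD for `𝒦` with continuous members, `F` the inner section by value.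
Then `hint : ∀ s, 0 < re s → ∀ y : H(𝔸), Integrable (u ↦ (β₁ u).toReal • f_s(w₀·(u·y))) νN` and `hFhol : ∀ y, DifferentiableOn ℂ (s ↦ F_s y) {0 < re}` — the two binders of ★
`K2LiuSiegelEisensteinMiddleTermOfStandardLevel.exists_middleTerm_package_of_standard_level` BYTE FOR BYTE.  Proof: ★ C-part's corner line `n₂` (`μ := Measure.addHaar` over `borel`, as ★ I4 §2);
the height letter on it by cases — `e (1,0) = 1`: chart of the second line + ★ FILE 2 `integrable_cornerLine_height`; `e (1,0) = 0`: chart of the first line + ★ FILE 2 ED. 2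
`integrable_cornerLine_height_inl` (★ `K2LiuCornerLineChartTwoInl`); Haar by ★ `isHaarMeasure_map_lineChart` at either line; then ★ FILE 1 `integrable_corner_of_height` (all `y`) through ★ C-part's
transfer, and ★ FILE 1 `differentiableOn_corner_of_height` through ★ C-part's unfolding.
[cite: MoeglinWaldspurger1995, II.1.7, IV.1.9] [cite: KudlaRallis1994, §2 (2.10)–(2.12)] [cite: Tan1999, §4 Prop. 4.8] [cite: Kudla1994, §2] [cite: Conway1978, IV §2] -/
theorem hint_and_hFhol_of_standard'
    (νN : Measure (unipDelta L e dV hdV dW hdW)) [νN.IsHaarMeasure] {β₁ : unipDelta L e dV hdV dW hdW → ℝ≥0∞} (hβ₁ : IsCoveringWeight Γ₀ β₁)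
    {χ : HeckeCharacter L} (hχ : χ.IsUnitary) (𝒦 : IwasawaDatum L e dV hdV dW hdW)
    (f : ℂ → HA L e dV hdV dW hdW → ℂ) (hstd : IsStandardSectionFamily 𝒦 χ f) (hcont : ∀ s : ℂ, Continuous (f s))
    (F : ℂ → HA L e dV hdV dW hdW → ℂ)
    (hF : ∀ (s : ℂ) (x : HA L e dV hdV dW hdW), F s x = ∫ u, (β₁ u).toReal • f s ((iotaGG L e dV hdV dW hdW (1, UnitaryGroup.rationalPairToAdelic (Fp L) L (IsCMField.complexConj L) (1 + 1) 1 (Matrix.diagonal dV) (Matrix.diagonal dW) g₀)) * ((u : HA L e dV hdV dW hdW) * x)) ∂νN) :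
    (∀ s : ℂ, 0 < s.re → ∀ y : HA L e dV hdV dW hdW,
      Integrable (fun u : unipDelta L e dV hdV dW hdW => (β₁ u).toReal • f s ((iotaGG L e dV hdV dW hdW (1, UnitaryGroup.rationalPairToAdelic (Fp L) L (IsCMField.complexConj L) (1 + 1) 1 (Matrix.diagonal dV) (Matrix.diagonal dW) g₀)) * ((u : HA L e dV hdV dW hdW) * y))) νN) ∧
    (∀ y : HA L e dV hdV dW hdW, DifferentiableOn ℂ (fun s => F s y) {s : ℂ | 0 < s.re}) := by
  -- the additive Haar measure of `𝔸_{L⁺}` over `borel` and ★ C-part's corner line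
  letI : MeasurableSpace (AdeleRing (𝓞 (Fp L)) (Fp L)) := borel _
  haveI : BorelSpace (AdeleRing (𝓞 (Fp L)) (Fp L)) := ⟨rfl⟩
  haveI := secondCountableTopology_adeleRing (Fp L)
  haveI := locallyCompactSpace_adeleRing' (Fp L)
  obtain ⟨n₂, Cu, -, -, hn₂c, -, hn₂mem, hn₂X, -, hunf⟩ :=
    inner_section_unfold L e dV hdV dW hdW hg₀ Λ hΛ hdV0 hdW0 νN (Measure.addHaar : Measure (AdeleRing (𝓞 (Fp L)) (Fp L)))
  -- the height letter on this corner line, in both orientations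
  have hJ : ∀ σ : ℝ, 0 < σ → Integrable (fun t => modDelta L e dV hdV dW hdW (𝒦.pPart ((iotaGG L e dV hdV dW hdW (1, UnitaryGroup.rationalPairToAdelic (Fp L) L (IsCMField.complexConj L) (1 + 1) 1 (Matrix.diagonal dV) (Matrix.diagonal dW) g₀)) * n₂ t)) ^ (2 * σ + ((2 : ℕ) : ℝ)))
      (Measure.addHaar : Measure (AdeleRing (𝓞 (Fp L)) (Fp L))) := by
    intro σ hσ
    rw [Nat.cast_ofNat]
    by_cases he : e (1, 0) = 1
    · -- the corner is the SECOND line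
      obtain ⟨nB, hnBc, hnBadd, hnBX⟩ := exists_lineChart L (Equiv.prodUnique (Fin 1) (Fin 1)) (fun j => dV (Fin.natAdd 1 j)) (fun j => hdV (Fin.natAdd 1 j)) dW hdW
      letI mB : MeasurableSpace (unipDelta L (Equiv.prodUnique (Fin 1) (Fin 1)) (fun j => dV (Fin.natAdd 1 j)) (fun j => hdV (Fin.natAdd 1 j)) dW hdW) := borel _
      haveI hB : BorelSpace (unipDelta L (Equiv.prodUnique (Fin 1) (Fin 1)) (fun j => dV (Fin.natAdd 1 j)) (fun j => hdV (Fin.natAdd 1 j)) dW hdW) := ⟨rfl⟩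
      haveI hH := isHaarMeasure_map_lineChart L (Equiv.prodUnique (Fin 1) (Fin 1)) (fun j => dV (Fin.natAdd 1 j)) (fun j => hdV (Fin.natAdd 1 j)) dW hdW (fun j => hdV0 _) hdW0
        (Measure.addHaar : Measure (AdeleRing (𝓞 (Fp L)) (Fp L))) nB hnBc hnBadd hnBX
      exact integrable_cornerLine_height L e (Equiv.prodUnique (Fin 1) (Fin 1)) (Equiv.prodUnique (Fin 1) (Fin 1)) (fun i => dV (Fin.castAdd 1 i)) (fun i => hdV (Fin.castAdd 1 i)) (fun j => dV (Fin.natAdd 1 j)) (fun j => hdV (Fin.natAdd 1 j)) (fun j => hdV0 _) dV hdV hdV0 (fun _ => rfl) (fun _ => rfl) dW hdW hdW0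
        he hg₀ _ nB hnBc.measurable.aemeasurable hH n₂
        (fun t => cornerLine_eq_blkD_lineChart L e (Equiv.prodUnique (Fin 1) (Fin 1)) (Equiv.prodUnique (Fin 1) (Fin 1)) (fun i => dV (Fin.castAdd 1 i)) (fun i => hdV (Fin.castAdd 1 i)) (fun j => dV (Fin.natAdd 1 j)) (fun j => hdV (Fin.natAdd 1 j)) dV hdV (fun _ => rfl) (fun _ => rfl) dW hdW he nB hnBX n₂ hn₂mem hn₂X t) 𝒦 hσ
    · -- the corner is the FIRST line
      have he0 : e (1, 0) = 0 := by
        have h2 : e (1, 0) = 0 ∨ e (1, 0) = 1 := by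
          generalize e (1, 0) = i
          fin_cases i <;> simp
        exact h2.resolve_right he
      obtain ⟨nA, hnAc, hnAadd, hnAX⟩ := exists_lineChart L (Equiv.prodUnique (Fin 1) (Fin 1)) (fun i => dV (Fin.castAdd 1 i)) (fun i => hdV (Fin.castAdd 1 i)) dW hdW
      letI mA : MeasurableSpace (unipDelta L (Equiv.prodUnique (Fin 1) (Fin 1)) (fun i => dV (Fin.castAdd 1 i)) (fun i => hdV (Fin.castAdd 1 i)) dW hdW) := borel _
      haveI hA : BorelSpace (unipDelta L (Equiv.prodUnique (Fin 1) (Fin 1)) (fun i => dV (Fin.castAdd 1 i)) (fun i => hdV (Fin.castAdd 1 i)) dW hdW) := ⟨rfl⟩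
      haveI hH := isHaarMeasure_map_lineChart L (Equiv.prodUnique (Fin 1) (Fin 1)) (fun i => dV (Fin.castAdd 1 i)) (fun i => hdV (Fin.castAdd 1 i)) dW hdW (fun i => hdV0 _) hdW0
        (Measure.addHaar : Measure (AdeleRing (𝓞 (Fp L)) (Fp L))) nA hnAc hnAadd hnAX
      exact integrable_cornerLine_height_inl L e (Equiv.prodUnique (Fin 1) (Fin 1)) (Equiv.prodUnique (Fin 1) (Fin 1)) (fun i => dV (Fin.castAdd 1 i)) (fun i => hdV (Fin.castAdd 1 i)) (fun j => dV (Fin.natAdd 1 j)) (fun j => hdV (Fin.natAdd 1 j)) dV hdV hdV0 (fun _ => rfl) (fun _ => rfl) dW hdW hdW0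
        he0 (fun i => hdV0 _) hg₀ _ nA hnAc.measurable.aemeasurable hH n₂
        (fun t => cornerLine_eq_blkD_lineChart_inl L e (Equiv.prodUnique (Fin 1) (Fin 1)) (Equiv.prodUnique (Fin 1) (Fin 1)) (fun i => dV (Fin.castAdd 1 i)) (fun i => hdV (Fin.castAdd 1 i)) (fun j => dV (Fin.natAdd 1 j)) (fun j => hdV (Fin.natAdd 1 j)) dV hdV (fun _ => rfl) (fun _ => rfl) dW hdW he0 nA hnAX n₂ hn₂mem hn₂X t) 𝒦 hσ
  refine ⟨fun s hs y => ?_, fun y => ?_⟩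
  · -- `hint` on every translate: ★ C-part's transfer + ★ FILE 1 §3
    exact ((hunf Γ₀ hΓ₀ β₁ hβ₁ χ s (f s) (hstd.1.1 s) (hcont s)).1 y).1.2
      (integrable_corner_of_height L e dV hdV hdV0 dW hdW hdW0 𝒦 hχ hstd hcont (Measure.addHaar : Measure (AdeleRing (𝓞 (Fp L)) (Fp L))) _ n₂ hn₂c
        (hJ s.re hs) y hs rfl)
  · -- `hFhol`: ★ C-part's unfolding + ★ FILE 1 §4
    have hunfold : ∀ s : ℂ, F s y = ((Cu.toReal : ℝ) : ℂ) * ∫ t,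
        f s ((iotaGG L e dV hdV dW hdW (1, UnitaryGroup.rationalPairToAdelic (Fp L) L (IsCMField.complexConj L) (1 + 1) 1 (Matrix.diagonal dV) (Matrix.diagonal dW) g₀)) * n₂ t * y) ∂(Measure.addHaar : Measure (AdeleRing (𝓞 (Fp L)) (Fp L))) :=
      fun s => (hunf Γ₀ hΓ₀ β₁ hβ₁ χ s (f s) (hstd.1.1 s) (hcont s)).2 (F s) (hF s) y
    exact (differentiableOn_corner_of_height L e dV hdV hdV0 dW hdW hdW0 𝒦 hχ hstd hcont (Measure.addHaar : Measure (AdeleRing (𝓞 (Fp L)) (Fp L))) _ n₂ hn₂c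
      hJ y ((Cu.toReal : ℝ) : ℂ)).congr fun s _ => hunfold s

end Summit.HodgeConjecture.HodgeConjecture.Cruxes.HLiu418.K2LiuSiegelMiddleTermCornerLetters

end
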